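import Mathlib
import Literature.NumberTheory.Transcendental.GammaFields
import Literature.NumberTheory.Transcendental.GammaIsoAlgebraicStep
import Summits.Schanuel.Schanuel.Theorems.RigidCoreAclSubsetLogFreeCoreDoubleModelTransport
import Summits.Schanuel.Schanuel.Theorems.RigidCoreAclSubsetLogFreeCoreCaseIILstep
import Summits.Schanuel.Schanuel.Theorems.RigidCoreAclSubsetLogFreeCoreAffineKill
import Summits.Schanuel.Schanuel.Theorems.RigidCoreAclSubsetLogFreeCoreCaseIITower

/-!
# Case II core, file 2: an exponential automorphism fixing the base and shifting a branch
(helper file for the registered stub `stub_caseII_core` of line `eac-extends-core-automorphisms`,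
crux stmt-Schanuel-0968 `Summit.Schanuel.Schanuel.Theses.RigidCore.AclSubsetLogFreeCore`)

Setting: an exponential field `E` of characteristic `0`, a ring automorphism `θ` of `E` commuting
with `exp`, a `ℚ`-subspace `X` fixed pointwise by `θ`.

* Transport: `θ` preserves relative algebraic closures and Γ-field generators (`apply_mem_acl_iff`,
  `gens_map`), hence the base closure `B = acl (gens X)` is `θ`-stable (`apply_mem_baseAcl_iff`) and
  `θ` is the identity on the `ℚ`-algebra `ℚ[gens X]` (`apply_eq_self_of_mem_adjoin_gens`).
* **Local finiteness on the base**: every element of `B` has a finite `θ`-orbit, indeed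
  `θ^[n] b = b` for some `n ≥ 1` (`exists_iterate_apply_eq_self_of_mem_baseAcl`): `θ` permutes the
  finitely many roots of a `θ`-invariant polynomial.
* Stability of subspaces: `Λ.map θ = Λ` for `Λ` fixed pointwise, for `V = X + ℚℓ` when `θ ℓ = ℓ + qτ`
  with `τ ∈ X` (`map_base_eq`), and then for every level of the canonical tower of `V ≤ U` as soon as
  `U.map θ = U` (`map_tower_eq`).
* Level `0` of the core claim is in the sequel file `…CaseIIShiftZero`.
-/

noncomputable section

set_option linter.dupNamespace false

open Set Polynomial
open Literature.ModelTheory.ExponentialFields Literature.ModelTheory.ExponentialFields.ExponentialRing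
open Literature.NumberTheory.Transcendental Literature.NumberTheory.Transcendental.GammaField

namespace Summit.Schanuel.Schanuel.Theorems.RigidCore

namespace CaseIICore

variable {E : Type*} [Field E] [CharZero E] [ExponentialRing E]

/-! ### Transport of `acl` and `gens` under an exponential automorphism -/

omit [ExponentialRing E] in
/-- `θ` as a `ℚ`-linear map agrees with `θ`. [folklore] -/
theorem toRatLinearMap_apply (θ : E ≃+* E) (x : E) :
    θ.toAddMonoidHom.toRatLinearMap x = θ x := rfl

omit [ExponentialRing E] in
/-- A ring automorphism reflects and preserves relative algebraic closures. [folklore] -/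
theorem apply_mem_acl_iff (θ : E ≃+* E) {S : Set E} {u : E} : θ u ∈ acl (θ '' S) ↔ u ∈ acl S :=
  mem_acl_image_iff θ.toRingHom

omit [ExponentialRing E] in
/-- The image of a relative algebraic closure under a ring automorphism. [folklore] -/
theorem image_acl (θ : E ≃+* E) (S : Set E) : θ '' acl S = acl (θ '' S) := by
  ext y
  constructor
  · rintro ⟨u, hu, rfl⟩
    exact (apply_mem_acl_iff θ).2 hu
  · intro hy
    refine ⟨θ.symm y, (apply_mem_acl_iff θ).1 ?_, θ.apply_symm_apply y⟩
    rwa [θ.apply_symm_apply]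

/-- Γ-field generators through an exponential automorphism: `gens (θ Λ) = θ (gens Λ)`. [folklore] -/
theorem gens_map (θ : E ≃+* E) (hθ : ∀ x, θ (exp x) = exp (θ x)) (Λ : Submodule ℚ E) :
    gens (Λ.map θ.toAddMonoidHom.toRatLinearMap) = θ '' gens Λ := by
  rw [gens_map_eq θ.toRingHom θ.toAddMonoidHom.toRatLinearMap (fun _ => rfl) exp
    (fun x _ => (hθ x).symm)]
  rfl

/-- `acl ∘ gens` through an exponential automorphism. [folklore] -/
theorem acl_gens_map (θ : E ≃+* E) (hθ : ∀ x, θ (exp x) = exp (θ x)) (Λ : Submodule ℚ E) :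
    acl (gens (Λ.map θ.toAddMonoidHom.toRatLinearMap)) = θ '' acl (gens Λ) := by
  rw [gens_map θ hθ, image_acl]

omit [ExponentialRing E] in
/-- A subspace fixed pointwise is mapped onto itself. [folklore] -/
theorem map_eq_of_forall_apply_eq (θ : E ≃+* E) {Λ : Submodule ℚ E} (h : ∀ x ∈ Λ, θ x = x) :
    Λ.map θ.toAddMonoidHom.toRatLinearMap = Λ := by
  ext y
  rw [Submodule.mem_map]
  constructor
  · rintro ⟨x, hx, rfl⟩
    rw [toRatLinearMap_apply, h x hx]; exact hx
  · exact fun hy => ⟨y, hy, h y hy⟩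

omit [ExponentialRing E] in
/-- Membership in `Λ.map θ`. [folklore] -/
theorem mem_map_iff_symm_mem (θ : E ≃+* E) {Λ : Submodule ℚ E} {y : E} :
    y ∈ Λ.map θ.toAddMonoidHom.toRatLinearMap ↔ θ.symm y ∈ Λ := by
  rw [Submodule.mem_map]
  constructor
  · rintro ⟨x, hx, rfl⟩
    rw [toRatLinearMap_apply, θ.symm_apply_apply]; exact hx
  · exact fun hy => ⟨θ.symm y, hy, θ.apply_symm_apply y⟩

omit [ExponentialRing E] in
/-- `Λ.map θ = Λ` in terms of membership: `Λ` is `θ`-stable in both directions. [folklore] -/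
theorem map_eq_iff_forall_mem_iff (θ : E ≃+* E) {Λ : Submodule ℚ E} :
    Λ.map θ.toAddMonoidHom.toRatLinearMap = Λ ↔ ∀ u, u ∈ Λ ↔ θ u ∈ Λ := by
  constructor
  · intro h u
    constructor
    · intro hu
      have hmem : θ u ∈ Λ.map θ.toAddMonoidHom.toRatLinearMap := ⟨u, hu, rfl⟩
      rwa [h] at hmem
    · intro hu
      have hmem : θ u ∈ Λ.map θ.toAddMonoidHom.toRatLinearMap := by rw [h]; exact hu
      rw [mem_map_iff_symm_mem, θ.symm_apply_apply] at hmem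
      exact hmem
  · intro h
    ext y
    rw [mem_map_iff_symm_mem, h (θ.symm y), θ.apply_symm_apply]

/-! ### The base: pointwise fixed `X`, its Γ-field and the closure `B = acl (gens X)` -/

/-- An exponential automorphism fixing `X` pointwise fixes `gens X` pointwise. [folklore] -/
theorem apply_eq_self_of_mem_gens (θ : E ≃+* E) (hθ : ∀ x, θ (exp x) = exp (θ x))
    {X : Submodule ℚ E} (hX : ∀ x ∈ X, θ x = x) {y : E} (hy : y ∈ gens X) : θ y = y := by
  rcases mem_gens_iff.1 hy with hy | ⟨x, hx, rfl⟩
  · exact hX y hy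
  · rw [hθ, hX x hx]

/-- … hence it fixes the `ℚ`-algebra `ℚ[gens X]` pointwise. [folklore] -/
theorem apply_eq_self_of_mem_adjoin_gens (θ : E ≃+* E) (hθ : ∀ x, θ (exp x) = exp (θ x))
    {X : Submodule ℚ E} (hX : ∀ x ∈ X, θ x = x) {y : E}
    (hy : y ∈ Algebra.adjoin ℚ (gens X)) : θ y = y := by
  refine Algebra.adjoin_induction (fun z hz => apply_eq_self_of_mem_gens θ hθ hX hz)
    (fun q => ?_) (fun a b _ _ ha hb => by rw [map_add, ha, hb])
    (fun a b _ _ ha hb => by rw [map_mul, ha, hb]) hy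
  exact map_ratCast θ q

/-- `θ` maps `gens X` onto itself. [folklore] -/
theorem image_gens_base (θ : E ≃+* E) (hθ : ∀ x, θ (exp x) = exp (θ x))
    {X : Submodule ℚ E} (hX : ∀ x ∈ X, θ x = x) : θ '' gens X = gens X := by
  ext y
  constructor
  · rintro ⟨z, hz, rfl⟩
    rwa [apply_eq_self_of_mem_gens θ hθ hX hz]
  · exact fun hy => ⟨y, hy, apply_eq_self_of_mem_gens θ hθ hX hy⟩

/-- **The base closure `B = acl (gens X)` is `θ`-stable.** [folklore] -/
theorem apply_mem_baseAcl_iff (θ : E ≃+* E) (hθ : ∀ x, θ (exp x) = exp (θ x))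
    {X : Submodule ℚ E} (hX : ∀ x ∈ X, θ x = x) {b : E} :
    θ b ∈ acl (gens X) ↔ b ∈ acl (gens X) := by
  conv_lhs => rw [← image_gens_base θ hθ hX]
  exact apply_mem_acl_iff θ

/-- Iterates of `θ` keep `B` stable. [folklore] -/
theorem iterate_apply_mem_baseAcl (θ : E ≃+* E) (hθ : ∀ x, θ (exp x) = exp (θ x))
    {X : Submodule ℚ E} (hX : ∀ x ∈ X, θ x = x) {b : E} (hb : b ∈ acl (gens X)) (n : ℕ) :
    θ^[n] b ∈ acl (gens X) := by
  induction n with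
  | zero => exact hb
  | succ n ih => rw [Function.iterate_succ_apply']; exact (apply_mem_baseAcl_iff θ hθ hX).2 ih

/-- **Local finiteness of `θ` on the base closure**: every `b ∈ B = acl (gens X)` returns to
itself under some positive iterate of `θ` — `θ` permutes the finitely many roots in `E` of a
non-zero polynomial over the pointwise fixed `ℚ`-algebra `ℚ[gens X]` killing `b`. [folklore] -/
theorem exists_iterate_apply_eq_self_of_mem_baseAcl (θ : E ≃+* E) (hθ : ∀ x, θ (exp x) = exp (θ x))
    {X : Submodule ℚ E} (hX : ∀ x ∈ X, θ x = x) {b : E} (hb : b ∈ acl (gens X)) :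
    ∃ n : ℕ, 0 < n ∧ θ^[n] b = b := by
  classical
  rw [mem_acl_iff] at hb
  obtain ⟨P, hP0, hPb⟩ := hb
  set Q : E[X] := P.map (algebraMap (Algebra.adjoin ℚ (gens X)) E) with hQ
  have hQ0 : Q ≠ 0 := (Polynomial.map_ne_zero_iff (FaithfulSMul.algebraMap_injective _ _)).2 hP0
  -- all iterates of `b` are roots of `Q`
  have hcoeff : ∀ n, θ (Q.coeff n) = Q.coeff n := fun n => by
    rw [hQ, coeff_map]
    exact apply_eq_self_of_mem_adjoin_gens θ hθ hX (P.coeff n).2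
  have hQθ : Q.map θ.toRingHom = Q := by
    ext n; rw [coeff_map]; exact hcoeff n
  have key : ∀ x : E, θ (Q.eval x) = Q.eval (θ x) := fun x => by
    have h := Polynomial.hom_eval₂ Q (RingHom.id E) θ.toRingHom x
    rw [RingHom.comp_id, eval₂_eq_eval_map, eval₂_eq_eval_map, Polynomial.map_id, hQθ] at h
    exact h
  have hroot : ∀ n : ℕ, Q.IsRoot (θ^[n] b) := by
    intro n
    induction n with
    | zero =>
      rw [Function.iterate_zero_apply, IsRoot, hQ, eval_map, ← aeval_def]
      exact hPb
    | succ n ih =>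
      rw [Function.iterate_succ_apply', IsRoot, ← key, ih, map_zero]
  -- pigeonhole on the finite root set
  have hfin : (Q.roots.toFinset : Set E).Finite := Finset.finite_toSet _
  have hmaps : ∀ n : ℕ, θ^[n] b ∈ (Q.roots.toFinset : Set E) := fun n => by
    rw [Finset.mem_coe, Multiset.mem_toFinset, mem_roots hQ0]; exact hroot n
  obtain ⟨m, n, hmn, heq⟩ := hfin.exists_lt_map_eq_of_forall_mem hmaps
  refine ⟨n - m, Nat.sub_pos_of_lt hmn, ?_⟩
  have hinj : Function.Injective (θ^[m]) := Function.Injective.iterate θ.injective m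
  apply hinj
  rw [← Function.iterate_add_apply, Nat.add_sub_cancel' (le_of_lt hmn)]
  exact heq.symm

omit [CharZero E] in
/-- Iterates of a ring automorphism are ring automorphisms. [folklore] -/
theorem exists_ringEquiv_iterate (θ : E ≃+* E) (hθ : ∀ x, θ (exp x) = exp (θ x)) (n : ℕ) :
    ∃ ψ : E ≃+* E, (∀ x, ψ x = θ^[n] x) ∧ ∀ x, ψ (exp x) = exp (ψ x) := by
  induction n with
  | zero => exact ⟨RingEquiv.refl E, fun x => rfl, fun x => rfl⟩
  | succ n ih =>
    obtain ⟨ψ, hψ, hψexp⟩ := ih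
    refine ⟨ψ.trans θ, fun x => ?_, fun x => ?_⟩
    · rw [RingEquiv.trans_apply, hψ, Function.iterate_succ_apply']
    · rw [RingEquiv.trans_apply, RingEquiv.trans_apply, hψexp, hθ]

omit [CharZero E] [ExponentialRing E] in
/-- Iterates of `θ` fix what `θ` fixes. [folklore] -/
theorem iterate_apply_eq_self (θ : E ≃+* E) {x : E} (h : θ x = x) (n : ℕ) : θ^[n] x = x :=
  Function.iterate_fixed h n

omit [ExponentialRing E] in
/-- **The branch shift iterated**: if `θ ℓ = ℓ + α` with `θ α = α` then `θⁿ ℓ = ℓ + n α`. [folklore] -/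
theorem iterate_apply_branch (θ : E ≃+* E) {ℓ α : E} (hα : θ α = α) (hℓ : θ ℓ = ℓ + α) (n : ℕ) :
    θ^[n] ℓ = ℓ + (n : E) * α := by
  induction n with
  | zero => simp
  | succ n ih =>
    rw [Function.iterate_succ_apply', ih, map_add, map_mul, map_natCast, hℓ, hα]
    push_cast
    ring

omit [CharZero E] [ExponentialRing E] in
/-- The orbit of a periodic point is finite. [folklore] -/
theorem finite_range_iterate_of_periodic (θ : E ≃+* E) {b : E} {p : ℕ} (hp : 0 < p)
    (hb : θ^[p] b = b) : (Set.range fun n : ℕ => θ^[n] b).Finite := by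
  have hper : Function.IsPeriodicPt θ p b := hb
  refine (Set.finite_range fun n : Fin p => θ^[n] b).subset ?_
  rintro _ ⟨n, rfl⟩
  exact ⟨⟨n % p, Nat.mod_lt n hp⟩, hper.iterate_mod_apply n⟩

/-! ### Stability of the base `V = X + ℚℓ` and of the level tower -/

omit [ExponentialRing E] in
/-- **`V = X + ℚℓ` is `θ`-stable** when `θ` fixes `X ∋ τ` pointwise and `θ ℓ = ℓ + q • τ`. [folklore] -/
theorem map_base_eq (θ : E ≃+* E) {X : Submodule ℚ E} (hX : ∀ x ∈ X, θ x = x) {τ ℓ : E}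
    (hτX : τ ∈ X) (q : ℚ) (hθℓ : θ ℓ = ℓ + q • τ) :
    (X ⊔ Submodule.span ℚ {ℓ}).map θ.toAddMonoidHom.toRatLinearMap = X ⊔ Submodule.span ℚ {ℓ} := by
  rw [map_eq_iff_forall_mem_iff]
  -- both `θ` and `θ⁻¹` map `V` into `V`
  have hfwd : ∀ u ∈ X ⊔ Submodule.span ℚ {ℓ}, θ u ∈ X ⊔ Submodule.span ℚ {ℓ} := by
    intro u hu
    obtain ⟨x, hx, z, hz, rfl⟩ := Submodule.mem_sup.1 hu
    obtain ⟨r, rfl⟩ := Submodule.mem_span_singleton.1 hz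
    rw [map_add, hX x hx, map_rat_smul, hθℓ, smul_add, ← add_assoc, add_comm x, add_assoc]
    exact Submodule.add_mem _ (Submodule.mem_sup_right (Submodule.smul_mem _ _ (Submodule.mem_span_singleton_self ℓ)))
      (Submodule.mem_sup_left (X.add_mem hx (X.smul_mem _ (X.smul_mem _ hτX))))
  have hsymmℓ : θ.symm ℓ = ℓ - q • τ := by
    apply θ.injective
    rw [θ.apply_symm_apply, map_sub, hθℓ, map_rat_smul, hX τ hτX, add_sub_cancel_right]
  have hbwd : ∀ u ∈ X ⊔ Submodule.span ℚ {ℓ}, θ.symm u ∈ X ⊔ Submodule.span ℚ {ℓ} := by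
    intro u hu
    obtain ⟨x, hx, z, hz, rfl⟩ := Submodule.mem_sup.1 hu
    obtain ⟨r, rfl⟩ := Submodule.mem_span_singleton.1 hz
    have hxs : θ.symm x = x := by
      apply θ.injective; rw [θ.apply_symm_apply, hX x hx]
    rw [map_add, hxs, map_rat_smul, hsymmℓ, smul_sub, add_sub, add_comm x, ← add_sub]
    exact Submodule.add_mem _ (Submodule.mem_sup_right (Submodule.smul_mem _ _ (Submodule.mem_span_singleton_self ℓ)))
      (Submodule.mem_sup_left (X.sub_mem hx (X.smul_mem _ (X.smul_mem _ hτX))))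
  intro u
  refine ⟨hfwd u, fun hu => ?_⟩
  have := hbwd _ hu
  rwa [θ.symm_apply_apply] at this

/-- **The level tower is `θ`-stable** as soon as `V` and `U` are. [folklore] -/
theorem map_tower_eq (θ : E ≃+* E) (hθ : ∀ x, θ (exp x) = exp (θ x))
    {V U : Submodule ℚ E} {Y : ℕ → Submodule ℚ E}
    (hY0 : Y 0 = V) (hYs : ∀ s, Y (s + 1) = U ⊓ Submodule.span ℚ (acl (gens (Y s))))
    (hV : V.map θ.toAddMonoidHom.toRatLinearMap = V) (hU : U.map θ.toAddMonoidHom.toRatLinearMap = U) :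
    ∀ s, (Y s).map θ.toAddMonoidHom.toRatLinearMap = Y s
  | 0 => by rw [hY0]; exact hV
  | s + 1 => by
    have ih := map_tower_eq θ hθ hY0 hYs hV hU s
    rw [map_eq_iff_forall_mem_iff] at ih hU ⊢
    intro u
    rw [hYs s, Submodule.mem_inf, Submodule.mem_inf, mem_span_acl_iff, mem_span_acl_iff, ← hU u]
    apply and_congr_right'
    -- `θ (acl (gens (Y s))) = acl (gens (Y s))`
    have himg : θ '' acl (gens (Y s)) = acl (gens (Y s)) := by
      rw [← acl_gens_map θ hθ, (map_eq_iff_forall_mem_iff θ).2 ih]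
    constructor
    · intro hu
      rw [← himg]; exact ⟨u, hu, rfl⟩
    · intro hu
      rw [← himg] at hu
      obtain ⟨u', hu', he⟩ := hu
      rwa [← θ.injective he]

end CaseIICore

/-! ### Registered helper (crux stub list of stmt-Schanuel-0968) -/

/-- **Registered form of `CaseIICore.map_tower_eq`** (all binders explicit): the canonical level
tower of `V ≤ U` is `θ`-stable as soon as `V` and `U` are. [folklore] -/
theorem caseII_map_tower_eq {E : Type*} [Field E] [CharZero E] [ExponentialRing E]
    (θ : E ≃+* E) (hθ : ∀ x, θ (exp x) = exp (θ x))
    {V U : Submodule ℚ E} {Y : ℕ → Submodule ℚ E}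
    (hY0 : Y 0 = V) (hYs : ∀ s, Y (s + 1) = U ⊓ Submodule.span ℚ (acl (gens (Y s))))
    (hV : V.map θ.toAddMonoidHom.toRatLinearMap = V) (hU : U.map θ.toAddMonoidHom.toRatLinearMap = U)
    (s : ℕ) : (Y s).map θ.toAddMonoidHom.toRatLinearMap = Y s :=
  CaseIICore.map_tower_eq θ hθ hY0 hYs hV hU s

end Summit.Schanuel.Schanuel.Theorems.RigidCore
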